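import Summits.QuantumFields.BalabanUV.T4Continuum.Support.AveragingDeficitLiftMap

/-!
# AveragingDeficitFaceLift (T⁴ programme, node NE3, row NE3-R2, gen 2) — THE NON-ABELIAN LIFT (γ1): THE DIFFERENTIAL OF
# BAŁABAN'S AVERAGE (42) IS ONTO THE COARSE DIRECTIONS WITH A BOUNDED RIGHT INVERSE SUPPORTED ON ONE FACE BOND PER
# COARSE BOND — `∀ φ ∃ ψ, pushDir L V ψ (Ly) κ = φ(y, κ)` for ALL coarse bonds, `|ψ(b₀(c))| ≤ 2L^d|φ(c)|`, `ψ = 0` off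
# the bonds `b₀(c)`, `ψ` `𝔲(N)`-valued if `φ` is (file 3c of the non-abelian lift γ; files 1, 2, 3a, 3b:
# `AveragingDeficitTransportCalc`, `AveragingDeficitPushForwardLinear`, `AveragingDeficitFaceWords`, `AveragingDeficitLiftMap`)

HONEST FRAMING (cell `pub-balaban`, T4-DAG PAGE 1; unit `b2b-balaban-t4-ne3r2-p1` = owner of BINDER-OWNERS row NE3-R2,
gen 2).  The cell's T4 target is the finite-torus continuum limit of the unit-scale averaged loop expectations — NOT
infinite volume, NO mass gap, NOT Clay, NOT summit progress.  This file assembles the bondwise inversion of file 3b into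
a GLOBAL right inverse of the differential of (42) (record `t4/T4-EST-NE3-P2.md` §4 (γ1); input γ = `TangentLift` of
`T4ConvexResponse.dualResidual_le`), all [folklore], 0 sorry: §4 `mem_bondsOf_revWord`; THE FACE LIFT `faceLift` (value
`m(y,κ)` on `b₀(y,κ)`, zero elsewhere; `faceLift_faceSite`, `faceSupported_faceLift`, `isSkewDir_faceLift`); **`faceLift_agree`**
(on every contour of `c` the face lift agrees with the one-bond direction of `c` — file 3a's classification: the only
face bond on the loops `Γ_{c,x} ∪ (−Γ_c)` and on `Γ_c` is `b₀(c)`), so by the locality of the push-forward (file 2's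
`pushDir_congr`) `pushDir L V (faceLift m) (c) = liftMap_c (m c)`; **`exists_lift`** (loop bound `w`, `2048·L^d·w ≤ 1`) and
**`exists_lift_of_smallField`** (`liftSmall d L · a ≤ 1`, `liftSmall = 32768(d+1)(d+4)L^{d+2}`, via the tree's
`B7Prop2Explicit.norm_Wcx_sub_one_le`): `∃ ψ`, face-supported, `pushDir L V ψ (Ly) κ = φ(y,κ)` for all `(y, κ)`,
`|ψ(b₀(y,κ))| ≤ 2L^d|φ(y,κ)|`, and `ψ` is `𝔲(N)`-valued when `φ` is.  WHAT THIS IS NOT: the energy-norm cost (γ2)–(γ4)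
of the record (full-gradient control via the gauge condition (76)), periodicity bookkeeping of the lift on the torus,
anything about minimisers; NE3 ITSELF IS NOT PROVED (energy route: NE3(A) ⇐ ML ∧ R0 ∧ β ∧ γ); NE3 stays COND-free.
CITATION HEADER: no printed sentence is a hypothesis; the manuscripts under audit are not cited for any disputed step;
context: T. Bałaban, Commun. Math. Phys. **98** (1985) 17–51 [Balaban1985Averaging] ((42) p. 23, (44) p. 24, p. 25),
**102** (1985) 277–309 [Balaban1985Variational] ((75)–(76) p. 289, (83) p. 290: the constraints being lifted).
PLACEMENT: `Summits/QuantumFields/BalabanUV/` (human rule 2026-08-19).  Record: HOME `t4/T4-EST-NE3-R2.md` v0.3.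
-/

set_option autoImplicit false

open scoped BigOperators Matrix Matrix.Norms.L2Operator Topology
open NormedSpace Finset Filter

namespace Summit.QuantumFields.BalabanUV.T4Continuum.AveragingDeficitFaceLift

open Literature.MathematicalPhysics.QuantumFieldTheory.Balaban1983to89
open B7Prop1Explicit B7Prop2Explicit MatrixLog UnitaryModel
open T4AveragingDeficitWall hiding Site Plane Plaq Bond
open T4AveragingDeficitNonAbelian (Ad_mul Ad_sub)
open AveragingDeficitTransport AveragingDeficitLocality AveragingDeficitNearIdentity AveragingDeficitSideDeriv
open AveragingDeficitResidualPairing AveragingDeficitTransportCalc AveragingDeficitPushForwardLinear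
open AveragingDeficitFaceWords AveragingDeficitLiftMap

noncomputable section

variable {d : ℕ} {n : Type*} [Fintype n] [DecidableEq n]

local notation "𝕄" => Matrix n n ℂ
local notation "Site" => B7Prop1Explicit.Site

/-! ## §4 The global lift -/

omit [Fintype n] [DecidableEq n] in
/-- The bonds of a reversed word are bonds of the word. [folklore] -/
theorem mem_bondsOf_revWord : ∀ (x : Site d) (w : List (Letter d)) (b : Site d × Fin d),
    b ∈ bondsOf (x + disp w) (revWord w) → b ∈ bondsOf x w
  | x, [], b, hb => by simp at hb
  | x, l :: w, b, hb => by
    rw [revWord_cons, disp_cons, ← add_assoc, bondsOf_append, List.mem_append, disp_revWord,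
      show x + l.vec + disp w + -disp w = x + l.vec by abel] at hb
    rw [bondsOf_cons, List.mem_cons]
    rcases hb with hb | hb
    · exact Or.inr (mem_bondsOf_revWord (x + l.vec) w b hb)
    · left
      obtain ⟨μ, c⟩ := l
      cases c <;> simpa [bondsOf] using hb

open Classical in
/-- **THE FACE LIFT** of coarse data `m : (y, κ) ↦ 𝔤𝔩(N)`: value `m(y, κ)` on the face bond `b₀(y, κ)`, zero elsewhere.
[folklore] -/
def faceLift (L : ℕ) (m : Site d → Fin d → 𝕄) : Site d → Fin d → 𝕄 :=
  fun z i => if h : IsFaceBond L z i then m (Classical.choose h) i else 0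

omit [Fintype n] [DecidableEq n] in
/-- Value on a face bond. [folklore] -/
theorem faceLift_faceSite {L : ℕ} (hL : 1 ≤ L) (m : Site d → Fin d → 𝕄) (y : Site d) (κ : Fin d) :
    faceLift L m (faceSite L y κ) κ = m y κ := by
  unfold faceLift
  have h : IsFaceBond L (faceSite L y κ) κ := isFaceBond_faceSite L y κ
  rw [dif_pos h, ← eq_of_faceSite_eq hL (Classical.choose_spec h)]

omit [Fintype n] [DecidableEq n] in
/-- Zero off the face bonds. [folklore] -/
theorem faceSupported_faceLift (L : ℕ) (m : Site d → Fin d → 𝕄) : FaceSupported L (faceLift L m) := fun z i h => by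
  unfold faceLift; rw [dif_neg h]

omit [Fintype n] [DecidableEq n] in
/-- The face lift is `𝔲(N)`-valued when the data are. [folklore] -/
theorem isSkewDir_faceLift (L : ℕ) {m : Site d → Fin d → 𝕄} (hm : ∀ y κ, m y κ ∈ skewAdjoint 𝕄) :
    IsSkewDir (faceLift L m) := by
  intro z i
  unfold faceLift
  split_ifs
  · exact hm _ _
  · exact (skewAdjoint 𝕄).zero_mem

omit [Fintype n] [DecidableEq n] in
/-- **ON EVERY CONTOUR OF `c` THE FACE LIFT AGREES WITH THE ONE-BOND DIRECTION OF `c`** (file 3a's classification: the only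
face bond on the loops `Γ_{c,x} ∪ (−Γ_c)` and on `Γ_c` is `b₀(c)`). [folklore] -/
theorem faceLift_agree {L : ℕ} (hL : 1 ≤ L) (m : Site d → Fin d → 𝕄) (y : Site d) (κ : Fin d) (b : Site d × Fin d)
    (hb : (∃ r : Fin d → Fin L, b ∈ bondsOf ((L : ℤ) • y) (loopWord L κ (boxVec L r)))
      ∨ b ∈ bondsOf ((L : ℤ) • y) (seg κ (L : ℤ))) :
    faceLift L m b.1 b.2 = bondDir (faceSite L y κ) κ (m y κ) b.1 b.2 := by
  by_cases hf : IsFaceBond L b.1 b.2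
  · -- a face bond on a contour of `c` is `b₀(c)`
    have hb0 : b = (faceSite L y κ, κ) := by
      rcases hb with ⟨r, hb⟩ | hb
      · rw [loopWord, bondsOf_append, disp_gammaWord, List.mem_append, gammaWord, bondsOf_append, List.mem_append,
          bondsOf_append, List.mem_append, disp_treeWord, disp_append, disp_treeWord, disp_seg] at hb
        rcases hb with ((hb | hb) | hb) | hb
        · exact absurd hf (not_isFaceBond_of_mem_treeWord hL y r hb)
        · exact (face_of_mem_seg hL y κ r hb hf).2
        · rw [show (L : ℤ) • y + (boxVec L r + (L : ℤ) • e κ) = ((L : ℤ) • (y + e κ)) + disp (treeWord (boxVec L r)) by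
            rw [disp_treeWord, smul_add]; abel] at hb
          exact absurd hf (not_isFaceBond_of_mem_treeWord hL (y + e κ) r (mem_bondsOf_revWord _ _ b hb))
        · obtain ⟨j, hj, rfl⟩ := (mem_bondsOf_seg_neg_iff _ κ L b).mp hb
          have := face_of_mem_back hL y κ hj hf
          subst this
          simp only [Prod.mk.injEq, and_true, faceSite]
          module
      · exact face_of_mem_central hL y κ hb hf
    rw [hb0, bondDir_self, faceLift_faceSite hL]
  · rw [faceSupported_faceLift L m _ _ hf, faceSupported_bondDir L y κ _ _ _ hf]

/-- **THE LIFT (γ1) FOR BAŁABAN'S NON-LINEAR AVERAGE**: for `U(N)`-valued `V` with loop bound `w`, `2048·L^d·w ≤ 1`,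
at every coarse bond, EVERY coarse direction field `φ` is the push-forward of a face-supported fine direction `ψ` with
`|ψ(b₀(c))| ≤ 2L^d|φ(c)|`, `𝔲(N)`-valued if `φ` is. [cite: Balaban1985Averaging, (42) p.23; Balaban1985Variational, (75)–(76) p.289] -/
theorem exists_lift [Nonempty n] {L : ℕ} (hL : 1 ≤ L) {V : Site d → Fin d → 𝕄ˣ} (hV : IsUnitaryCfg V) {w : ℝ}
    (hw0 : 0 ≤ w) (hwL : 2048 * (L : ℝ) ^ d * w ≤ 1) (hW : ∀ (y : Site d) (κ : Fin d), LoopBound L V y κ w)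
    (φ : Site d → Fin d → 𝕄) :
    ∃ ψ : Site d → Fin d → 𝕄, FaceSupported L ψ ∧ (∀ (y : Site d) (κ : Fin d), pushDir L V ψ ((L : ℤ) • y) κ = φ y κ)
      ∧ (∀ (y : Site d) (κ : Fin d), ‖ψ (faceSite L y κ) κ‖ ≤ 2 * (L : ℝ) ^ d * ‖φ y κ‖)
      ∧ ((∀ (y : Site d) (κ : Fin d), φ y κ ∈ skewAdjoint 𝕄) → IsSkewDir ψ) := by
  have hLd : (1 : ℝ) ≤ (L : ℝ) ^ d := one_le_pow₀ (by exact_mod_cast hL)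
  have hw : w ≤ 1 / 32 := by nlinarith
  have hwL' : 2044 * (L : ℝ) ^ d * w ≤ 1 := by nlinarith
  -- bondwise preimages (skew when the datum is skew)
  have key : ∀ (y : Site d) (κ : Fin d), ∃ m : 𝕄, liftMap L V y κ hw (hW y κ) m = φ y κ ∧
      ‖m‖ ≤ 2 * (L : ℝ) ^ d * ‖φ y κ‖ ∧ (φ y κ ∈ skewAdjoint 𝕄 → m ∈ skewAdjoint 𝕄) := by
    intro y κ
    by_cases hφ : φ y κ ∈ skewAdjoint 𝕄
    · obtain ⟨m, hm, h1, h2⟩ := exists_preimage_skew hL hV y κ hw0 hwL' hw (hW y κ) hφ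
      exact ⟨m, h1, h2, fun _ => hm⟩
    · obtain ⟨m, h1, h2⟩ := exists_preimage hL hV y κ hw0 hwL' hw (hW y κ) (φ y κ)
      exact ⟨m, h1, h2, fun h => absurd h hφ⟩
  choose m hm1 hm2 hm3 using key
  refine ⟨faceLift L m, faceSupported_faceLift L m, fun y κ => ?_, fun y κ => ?_, fun hφ => ?_⟩
  · rw [← hm1 y κ, liftMap_apply]
    exact pushDir_congr L V _ κ (fun r b hb => faceLift_agree hL m y κ b (Or.inl ⟨r, hb⟩))
      fun b hb => faceLift_agree hL m y κ b (Or.inr hb)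
  · rw [faceLift_faceSite hL]; exact hm2 y κ
  · exact isSkewDir_faceLift L fun y κ => hm3 y κ (hφ y κ)

/-- The lift constant in terms of the small-field parameter: `32768(d+1)(d+4)L^{d+2}`. [folklore] -/
def liftSmall (d L : ℕ) : ℝ := 32768 * ((d : ℝ) + 1) * ((d : ℝ) + 4) * (L : ℝ) ^ (d + 2)

/-- **THE LIFT IN THE SMALL-FIELD CLASS**: for `U(N)`-valued `V` with `|V(∂p) − 1| ≤ a`, `0 ≤ a`,
`32768(d+1)(d+4)L^{d+2}·a ≤ 1`, every coarse direction field is the push-forward of a face-supported fine direction with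
`|ψ(b₀(c))| ≤ 2L^d|φ(c)|` (and `𝔲(N)`-valued if `φ` is). [cite: Balaban1985Averaging, (44) p.24, p.25] -/
theorem exists_lift_of_smallField [Nonempty n] {L : ℕ} (hL : 1 ≤ L) {V : Site d → Fin d → 𝕄ˣ} (hV : IsUnitaryCfg V)
    {a : ℝ} (ha : 0 ≤ a) (hsmall : liftSmall d L * a ≤ 1) (hVa : SmallField V a) (φ : Site d → Fin d → 𝕄) :
    ∃ ψ : Site d → Fin d → 𝕄, FaceSupported L ψ ∧ (∀ (y : Site d) (κ : Fin d), pushDir L V ψ ((L : ℤ) • y) κ = φ y κ)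
      ∧ (∀ (y : Site d) (κ : Fin d), ‖ψ (faceSite L y κ) κ‖ ≤ 2 * (L : ℝ) ^ d * ‖φ y κ‖)
      ∧ ((∀ (y : Site d) (κ : Fin d), φ y κ ∈ skewAdjoint 𝕄) → IsSkewDir ψ) := by
  have hL1 : (1 : ℝ) ≤ L := by exact_mod_cast hL
  have hLd : (1 : ℝ) ≤ (L : ℝ) ^ d := one_le_pow₀ hL1
  have hd0 : (0 : ℝ) ≤ d := Nat.cast_nonneg d
  unfold liftSmall at hsmall
  have hpow : (L : ℝ) ^ (d + 2) = (L : ℝ) ^ d * (L : ℝ) ^ 2 := by ring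
  rw [hpow] at hsmall
  -- the B7 smallness `512(d+1)(d+4)L²a ≤ 1`
  have h512 : 512 * (d + 1) * (d + 4) * (L : ℝ) ^ 2 * a ≤ 1 := by
    have : 512 * ((d : ℝ) + 1) * ((d : ℝ) + 4) * (L : ℝ) ^ 2 * a
        ≤ 32768 * ((d : ℝ) + 1) * ((d : ℝ) + 4) * ((L : ℝ) ^ d * (L : ℝ) ^ 2) * a := by
      have h0 : 0 ≤ ((d : ℝ) + 1) * ((d : ℝ) + 4) * (L : ℝ) ^ 2 * a := by positivity
      nlinarith
    linarith
  have hU : ∀ (x : Site d) (κ : Fin d), V x κ ∈ U1 𝕄 := fun x κ => mem_U1_of_unitary (hV x κ)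
  set w : ℝ := 2 * (8 * (d + 1) * (d + 4) * (L : ℝ) ^ 2 * a) with hw
  have hW : ∀ (y : Site d) (κ : Fin d), LoopBound L V y κ w := fun y κ r =>
    norm_Wcx_sub_one_le L hL V hU ha h512 hVa _ κ r
  have hw0 : 0 ≤ w := by rw [hw]; positivity
  have hwL : 2048 * (L : ℝ) ^ d * w ≤ 1 := by
    rw [hw]
    have : 2048 * (L : ℝ) ^ d * (2 * (8 * (d + 1) * (d + 4) * (L : ℝ) ^ 2 * a))
        = 32768 * ((d : ℝ) + 1) * ((d : ℝ) + 4) * ((L : ℝ) ^ d * (L : ℝ) ^ 2) * a := by ring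
    linarith
  exact exists_lift hL hV hw0 hwL hW φ

end

end Summit.QuantumFields.BalabanUV.T4Continuum.AveragingDeficitFaceLift
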